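import Summits.NavierStokesRegularity.NavierStokesRegularity.Theses.ScaledTopAlignment
import Summits.NavierStokesRegularity.NavierStokesRegularity.Theorems.ScaledTopAlignmentBulkRung
import HarnessLib

/-!
# Route `ScaledTopAlignment`: dominated-side rungs and the (CA) witness of the MOST-TIMES door W3ᵐᵗ
# = `AprioriMostTimesBulkAlignment` (stmt-NavierStokesRegularity-19551, load-bearing since rev 13–14), BY NAME

Planner p3 g3 TURNKEY (tribunal T3 for the new deciding crux). W3ᵐᵗ (θ-form most-times window-bulk door, the
hypothesis of `navierStokesRegularity_of_mostTimesWindowBulkAlignment_of_noTypeII`) is implied by every stronger door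
of the route — take the exceptional time set `E = ∅` and `θ = ½`:
* `mostTimesBulkAlignedAt_of_bulkAlignedAt` — at ONE solution: W3′'s bulk conclusion ⇒ W3ᵐᵗ's conclusion (λ₀ = ½, R₀ = 1,
  θ = ½, E = ∅; the rate clause is not used);
* `aprioriMostTimesBulkAlignment_of_aprioriWindowBulkAlignment` (W3ʷᵇ 19447 ⇒ W3ᵐᵗ), `…_of_aprioriScaledBulkAlignment`
  (W3′ 19438 ⇒ W3ᵐᵗ), `…_of_aprioriScaledTopAlignment` (W3 19901 ⇒ W3ᵐᵗ), `…_of_aprioriContinuousAlignment` (W1 18585 ⇒ W3ᵐᵗ);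
* `mostTimesBulkAlignedAt_of_continuousAlignmentAt` — the T3 WITNESS by name: a solution satisfying Giga–Miura's
  fixed-modulus (CA) on a vorticity level set satisfies W3ᵐᵗ's conclusion (via p5's `scaledBulkAlignedAt_of_continuousAlignmentAt`).
Implications between OPEN a-priori statements / a conditional special case; nothing here proves W3ᵐᵗ.
WHAT THIS IS NOT: not NS regularity. [folklore]
-/

noncomputable section
set_option linter.dupNamespace false
open MeasureTheory Set Filter Topology Literature.Analysis.FluidPDE

namespace Summit.NavierStokesRegularity.NavierStokesRegularity.Theorems

/-- **At one solution: bulk (W3′-type) conclusion ⇒ most-times (W3ᵐᵗ-type) conclusion** (λ₀ = ½, R₀ = 1, θ = ½,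
`E = ∅`). Abstract over the vorticity family `ω`. [folklore] -/
theorem mostTimesBulkAlignedAt_of_bulkAlignedAt {ν T : ℝ}
    {ω : ℝ → EuclideanSpace ℝ (Fin 3) → EuclideanSpace ℝ (Fin 3)}
    (hb : ∀ lam : ℝ, 0 < lam → lam < 1 → ∀ R : ℝ, 0 < R → ∀ ε : ℝ, 0 < ε → ∀ δ : ℝ, 0 < δ →
      ∃ M : ℝ, 0 < M ∧ ∀ t ∈ Set.Ico 0 T, ∀ x : EuclideanSpace ℝ (Fin 3), M ≤ ‖ω t x‖ →
        volume {y : EuclideanSpace ℝ (Fin 3) | lam * ‖ω t x‖ ≤ ‖ω t y‖ ∧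
            ‖x - y‖ ≤ R * Real.sqrt (ν / ‖ω t x‖) ∧
            ε < Real.sqrt (1 - (inner ℝ (‖ω t x‖⁻¹ • ω t x) (‖ω t y‖⁻¹ • ω t y)) ^ 2)}
          ≤ ENNReal.ofReal (δ * Real.sqrt (ν / ‖ω t x‖) ^ 3)) :
    ∃ lam0 : ℝ, lam0 < 1 ∧ ∃ R0 : ℝ, 0 < R0 ∧ ∃ θ : ℝ, θ < 1 ∧ ∀ κ : ℝ, 0 < κ → ∀ ε : ℝ, 0 < ε →
      ∀ δ : ℝ, 0 < δ → ∃ M : ℝ, 0 < M ∧ ∃ E : Set ℝ,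
        (∃ h0 : ℝ, 0 < h0 ∧ ∀ h : ℝ, 0 < h → h < h0 →
          volume (E ∩ Set.Ioo (T - h) T) ≤ ENNReal.ofReal (θ * h)) ∧
        ∀ t ∈ Set.Ico 0 T, t ∉ E → ∀ x : EuclideanSpace ℝ (Fin 3), M ≤ ‖ω t x‖ → κ / (T - t) ≤ ‖ω t x‖ →
          volume {y : EuclideanSpace ℝ (Fin 3) | lam0 * ‖ω t x‖ ≤ ‖ω t y‖ ∧
              ‖x - y‖ ≤ R0 * Real.sqrt (ν / ‖ω t x‖) ∧
              ε < Real.sqrt (1 - (inner ℝ (‖ω t x‖⁻¹ • ω t x) (‖ω t y‖⁻¹ • ω t y)) ^ 2)}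
            ≤ ENNReal.ofReal (δ * Real.sqrt (ν / ‖ω t x‖) ^ 3) := by
  refine ⟨1 / 2, by norm_num, 1, one_pos, 1 / 2, by norm_num, ?_⟩
  intro κ _hκ ε hε δ hδ
  obtain ⟨M, hM, hM'⟩ := hb (1 / 2) (by norm_num) (by norm_num) 1 one_pos ε hε δ hδ
  refine ⟨M, hM, ∅, ⟨1, one_pos, fun h _ _ => by simp⟩, ?_⟩
  intro t ht _ x hx _hrate
  simpa using hM' t ht x hx

/-- **W3′ ⇒ W3ᵐᵗ, BY NAME** (bulk door 19438 ⇒ most-times door 19551). [folklore] -/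
theorem aprioriMostTimesBulkAlignment_of_aprioriScaledBulkAlignment
    (hW : Summit.NavierStokesRegularity.NavierStokesRegularity.Theses.ScaledTopAlignment.AprioriScaledBulkAlignment) :
    Summit.NavierStokesRegularity.NavierStokesRegularity.Theses.ScaledTopAlignment.AprioriMostTimesBulkAlignment := by
  intro ν T hν hT u p hcl hLH hdec
  exact mostTimesBulkAlignedAt_of_bulkAlignedAt (ω := fun t => curl (u t)) (hW ν T hν hT u p hcl hLH hdec)

/-- **W3ʷᵇ ⇒ W3ᵐᵗ, BY NAME** (window-bulk door 19447 ⇒ most-times door 19551: `θ = ½`, `E = ∅`). [folklore] -/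
theorem aprioriMostTimesBulkAlignment_of_aprioriWindowBulkAlignment
    (hW : Summit.NavierStokesRegularity.NavierStokesRegularity.Theses.ScaledTopAlignment.AprioriWindowBulkAlignment) :
    Summit.NavierStokesRegularity.NavierStokesRegularity.Theses.ScaledTopAlignment.AprioriMostTimesBulkAlignment := by
  intro ν T hν hT u p hcl hLH hdec
  obtain ⟨lam0, hlam0, R0, hR0, hmain⟩ := hW ν T hν hT u p hcl hLH hdec
  refine ⟨lam0, hlam0, R0, hR0, 1 / 2, by norm_num, ?_⟩
  intro κ hκ ε hε δ hδ
  obtain ⟨M, hM, hM'⟩ := hmain κ hκ ε hε δ hδ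
  exact ⟨M, hM, ∅, ⟨1, one_pos, fun h _ _ => by simp⟩, fun t ht _ x hx hrate => hM' t ht x hx hrate⟩

/-- **W3 ⇒ W3ᵐᵗ, BY NAME** (pointwise door 19901 ⇒ most-times door 19551). [folklore] -/
theorem aprioriMostTimesBulkAlignment_of_aprioriScaledTopAlignment
    (hW3 : Summit.NavierStokesRegularity.NavierStokesRegularity.Theses.ScaledTopAlignment.AprioriScaledTopAlignment) :
    Summit.NavierStokesRegularity.NavierStokesRegularity.Theses.ScaledTopAlignment.AprioriMostTimesBulkAlignment :=
  aprioriMostTimesBulkAlignment_of_aprioriScaledBulkAlignment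
    (aprioriScaledBulkAlignment_of_aprioriScaledTopAlignment hW3)

/-- **W1 ⇒ W3ᵐᵗ, BY NAME** (residual crux W1 = `ContinuousAlignment.AprioriContinuousAlignment`, 18585 ⇒ 19551). [folklore] -/
theorem aprioriMostTimesBulkAlignment_of_aprioriContinuousAlignment
    (hW1 : Summit.NavierStokesRegularity.NavierStokesRegularity.Theses.ContinuousAlignment.AprioriContinuousAlignment) :
    Summit.NavierStokesRegularity.NavierStokesRegularity.Theses.ScaledTopAlignment.AprioriMostTimesBulkAlignment :=
  aprioriMostTimesBulkAlignment_of_aprioriScaledBulkAlignment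
    (aprioriScaledBulkAlignment_of_aprioriContinuousAlignment hW1)

/-- **T3 witness: (CA) at a solution implies W3ᵐᵗ's conclusion at that solution** (Giga–Miura's fixed-modulus
continuous alignment (CA) on a vorticity level set, signed chord form, any modulus; through p5's
`scaledBulkAlignedAt_of_continuousAlignmentAt`). [cite: GigaMiura2011, Thm 1.1 with condition (CA) (§1; HUPS preprint #956 p. 3)] -/
theorem mostTimesBulkAlignedAt_of_continuousAlignmentAt {ν T : ℝ} (hν : 0 < ν)
    {u : ℝ → EuclideanSpace ℝ (Fin 3) → EuclideanSpace ℝ (Fin 3)}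
    (hCA : ∃ d : ℝ, 0 < d ∧ ∃ η : ℝ → ℝ, Tendsto η (𝓝[>] 0) (𝓝 0) ∧
      ∀ t ∈ Ico 0 T, ∀ x y : EuclideanSpace ℝ (Fin 3), d < ‖curl (u t) x‖ → d < ‖curl (u t) y‖ →
        x ≠ y → ‖(‖curl (u t) x‖⁻¹ • curl (u t) x) - (‖curl (u t) y‖⁻¹ • curl (u t) y)‖ ≤ η ‖x - y‖) :
    ∃ lam0 : ℝ, lam0 < 1 ∧ ∃ R0 : ℝ, 0 < R0 ∧ ∃ θ : ℝ, θ < 1 ∧ ∀ κ : ℝ, 0 < κ → ∀ ε : ℝ, 0 < ε →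
      ∀ δ : ℝ, 0 < δ → ∃ M : ℝ, 0 < M ∧ ∃ E : Set ℝ,
        (∃ h0 : ℝ, 0 < h0 ∧ ∀ h : ℝ, 0 < h → h < h0 →
          volume (E ∩ Set.Ioo (T - h) T) ≤ ENNReal.ofReal (θ * h)) ∧
        ∀ t ∈ Set.Ico 0 T, t ∉ E → ∀ x : EuclideanSpace ℝ (Fin 3), M ≤ ‖curl (u t) x‖ →
          κ / (T - t) ≤ ‖curl (u t) x‖ →
          volume {y : EuclideanSpace ℝ (Fin 3) | lam0 * ‖curl (u t) x‖ ≤ ‖curl (u t) y‖ ∧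
              ‖x - y‖ ≤ R0 * Real.sqrt (ν / ‖curl (u t) x‖) ∧
              ε < Real.sqrt (1 - (inner ℝ (‖curl (u t) x‖⁻¹ • curl (u t) x)
                (‖curl (u t) y‖⁻¹ • curl (u t) y)) ^ 2)}
            ≤ ENNReal.ofReal (δ * Real.sqrt (ν / ‖curl (u t) x‖) ^ 3) :=
  mostTimesBulkAlignedAt_of_bulkAlignedAt (ω := fun t => curl (u t))
    (scaledBulkAlignedAt_of_continuousAlignmentAt hν hCA)

end Summit.NavierStokesRegularity.NavierStokesRegularity.Theorems

end
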